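import Summits.HubbardSuperconductivity.HubbardSuperconductivity.Theorems.ThermalWedgeTwPureThermalBoundGseeMaster
import Literature.MathematicalPhysics.QuantumLattice.HubbardTorus2DEnergyDensityConvex
import Literature.MathematicalPhysics.QuantumLattice.HubbardFreeTorusGroundEnergy
import Literature.MathematicalPhysics.QuantumLattice.TorusBandEdgeCounting
import Literature.MathematicalPhysics.QuantumLattice.HubbardGrandCanonicalDensity
import Summits.HubbardSuperconductivity.HubbardSuperconductivity.Theorems.ThermalWedgeTwPureThermalBoundReduction
import HarnessLib

/-!
# Route `ThermalWedge`, item `stmt-HubbardSuperconductivity-1702` (`TwPureThermalBound`):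
# the chemical-potential window, (GSEE), and the verbatim body of the item

Support file 2/3 (`--supports stmt-HubbardSuperconductivity-1702`; no definition). With the master
bounds of `…GseeMaster.lean`, the convexity of `e = energyDensity2D 1 U` on `[0,2)`
(`convexOn_energyDensity2D`), the free grand-canonical torus energies and their secant inequalities
(`HubbardFreeTorusGroundEnergy.lean`), the band-edge level counts (`TorusBandEdgeCounting.lean`) and
`0 ≤ E₀(K^U_μ) - E₀(K⁰_μ) ≤ UL²` (`HubbardGrandCanonicalDensity.lean`):

* `subgradient_le_upperEdge`, `lowerEdge_le_subgradient` — for small `U` every subgradient at a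
  density `n₀ ∈ [3/5, 9/10]` lies in `[-39/10, -cos²(49π/100)/2] ⊂ (-4, 0)` (if not, the
  grand-canonical ground sector at one end of a short `μ`-interval has the wrong particle number
  for the free-gas energy change across that interval);
* `gsee` — (GSEE): for `δ ∈ [1/10,2/5]`, `0 < U ≤ U₀`, with `μ` a subgradient at `1 - δ`, the
  `(N_L, S^z=0)` ground energy of the canonical torus is within `εL²` of the supporting line of slope
  `μ` under all sector energies, eventually in `L` (`groundEnergyAt_eq_minEnergyOn_szSector` for
  the `S^z = 0` sector);
* `twPureThermalBound_body` — the verbatim body of `ThermalWedge.TwPureThermalBound`, by the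
  reduction `twPureThermalBound_of_gsee` of `ThermalWedgeTwPureThermalBoundReduction.lean`.

(Ruelle, *Statistical Mechanics* (1969), §3.4: equivalence of the canonical and grand-canonical
descriptions at `T = 0` via convexity.) [cite: Ruelle1969, §3.4]
-/

set_option linter.dupNamespace false

noncomputable section

namespace Summit.HubbardSuperconductivity.HubbardSuperconductivity.Theorems.TwPureThermalBoundGsee

open Matrix Finset Filter Topology
open Literature.MathematicalPhysics.QuantumLattice Literature.MathematicalPhysics.QuantumLattice.ThermodynamicLimit
open Literature.Probability.LatticeModels
open scoped BigOperators

section Torus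

/-- **Upper end of the chemical-potential window.** With `c₁ = cos²(49π/100)` (the free density
just below the band centre is `≥ 19/20`, `card_filter_torusBand_lt_upperEdge`): for
`0 ≤ U ≤ c₁/200` and a density `n₀ ≤ 9/10`, every subgradient `s` at `n₀` of the energy density
`energyDensity2D 1 U` on `[0,2)` satisfies `s ≤ -c₁/2`. (If `s > -c₁/2`, the grand-canonical ground
sector at `μ₂ = -c₁/2` has `≤ (n₀ + 1/100)L²` particles, so lowering `μ` to `-c₁` raises `E₀` by at
most `(c₁/2)(n₀ + 1/100)L²`, while for the free gas it raises it by `≥ (19/20)(c₁/2)L²` and the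
interacting and free grand-canonical energies differ by `≤ UL²`.) [folklore] -/
theorem subgradient_le_upperEdge {U : ℝ} (hU0 : 0 ≤ U)
    (hU : U ≤ Real.cos (49 * Real.pi / 100) ^ 2 / 200) {n₀ : ℝ} (hn0 : 0 ≤ n₀) (hn9 : n₀ ≤ 9 / 10)
    {s : ℝ} (hs : ∀ y ∈ Set.Ico (0 : ℝ) 2,
      energyDensity2D 1 U n₀ + s * (y - n₀) ≤ energyDensity2D 1 U y) :
    s ≤ -(Real.cos (49 * Real.pi / 100) ^ 2) / 2 := by
  set c₁ : ℝ := Real.cos (49 * Real.pi / 100) ^ 2 with hc₁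
  have hc₁pos : 0 < c₁ := by have := upperEdge_neg; simp only [hc₁]; linarith
  by_contra hlt
  rw [not_le] at hlt
  set τ : ℝ := c₁ / 2 with hτ
  have hτpos : 0 < τ := by positivity
  have hn2 : n₀ < 2 := by linarith
  -- the gap and the slack
  set g : ℝ := s + τ with hg
  have hgpos : 0 < g := by simp only [hg, hτ]; linarith
  set η : ℝ := g / 200 with hη
  have hηpos : 0 < η := by positivity
  obtain ⟨L₁, hL₁⟩ := master_lb hU0 hs hηpos
  obtain ⟨L₂, hL₂⟩ := master_ub hU0 hn0 hn2 hηpos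
  set L : ℕ := max (max L₁ L₂) 400 with hL
  have hLL₁ : L₁ ≤ L := (le_max_left _ _).trans (le_max_left _ _)
  have hLL₂ : L₂ ≤ L := (le_max_right _ _).trans (le_max_left _ _)
  have hL400 : 400 ≤ L := le_max_right _ _
  haveI : NeZero L := ⟨by omega⟩
  have hL3 : 3 ≤ L := by omega
  have hLr : (400 : ℝ) ≤ L := by exact_mod_cast hL400
  have hL2pos : (0 : ℝ) < (L : ℝ) ^ 2 := by positivity
  set e₀ := energyDensity2D 1 U n₀ with he₀
  set E : ℕ → ℝ := fun N => groundEnergyAt (fermionTorusGraph 2 L) 1 U N with hE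
  set G : ℝ → ℝ := fun μ => (hubbardTorusWith 2 L 1 U μ).groundEnergy with hG
  set G0 : ℝ → ℝ := fun μ => (hubbardTorusWith 2 L 1 0 μ).groundEnergy with hG0
  -- (iii) upper bound on `G(μ₂)` through the sector `N_L(n₀)`
  have hNL := rectN_le_two_mul hn0 hn2.le L
  have h3 : G (-τ) ≤ (L : ℝ) ^ 2 * e₀ + η * (L : ℝ) ^ 2 + τ * (n₀ * (L : ℝ) ^ 2) := by
    have h1 := gc_le_sector L U (-τ) hNL
    have h2 := hL₂ L hLL₂
    have h4 := rectN_le hn0 L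
    have : -(-τ) * (rectN n₀ L : ℝ) ≤ τ * (n₀ * (L : ℝ) ^ 2) := by
      rw [neg_neg]; exact mul_le_mul_of_nonneg_left h4 hτpos.le
    simp only [hG]
    linarith
  -- (ii) the ground sector `N°` at `μ₂` and the master lower bound
  obtain ⟨N, hN2, hGN⟩ := exists_gcSector L U (-τ)
  have h2 := hL₁ L hLL₁ N hN2
  -- (*) `N° ≤ (n₀ + 1/100) L²`
  have hstar : (N : ℝ) ≤ (n₀ + 1 / 100) * (L : ℝ) ^ 2 := by
    have h5 : g * ((N : ℝ) - n₀ * (L : ℝ) ^ 2) ≤ 2 * η * (L : ℝ) ^ 2 := by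
      have : G (-τ) = E N - (-τ) * N := hGN
      simp only [hg]
      nlinarith [h2, h3, this]
    have h6 : (N : ℝ) - n₀ * (L : ℝ) ^ 2 ≤ 2 * η * (L : ℝ) ^ 2 / g := by
      rw [le_div_iff₀ hgpos]; linarith
    have h7 : 2 * η * (L : ℝ) ^ 2 / g = (L : ℝ) ^ 2 / 100 := by
      simp only [hη]; field_simp; ring
    rw [h7] at h6
    linarith
  -- (iv) `G(ν) ≤ G(μ₂) + τ N°`
  have h4 : G (-c₁) ≤ G (-τ) + τ * N := by
    have h1 := gc_le_sector L U (-c₁) hN2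
    have : G (-τ) = E N - (-τ) * N := hGN
    simp only [hG] at *
    have hc : -(-c₁) * (N : ℝ) = τ * N + τ * N := by simp only [hτ]; ring
    linarith
  -- (v) free comparison
  have h5 : G (-τ) ≤ G (-c₁) - 19 / 20 * τ * (L : ℝ) ^ 2 + U * (L : ℝ) ^ 2 := by
    have hA := (groundEnergy_torus_sub_free_mem_Icc L 1 (-τ) hU0).2
    have hB := (groundEnergy_torus_sub_free_mem_Icc L 1 (-c₁) hU0).1
    have hC := groundEnergy_free_le_sub_card (L := L) hL3 (μ := -τ) (μ' := -c₁) (by simp only [hτ]; linarith)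
    have hD := card_filter_torusBand_lt_upperEdge (L := L) hL400
    have hτ' : (-τ - -c₁) = τ := by simp only [hτ]; ring
    rw [hτ'] at hC
    simp only [hG, hG0] at *
    nlinarith [hC, hD, hτpos]
  -- contradiction
  have h6 : 19 / 20 * τ * (L : ℝ) ^ 2 ≤ U * (L : ℝ) ^ 2 + τ * ((n₀ + 1 / 100) * (L : ℝ) ^ 2) := by
    have := mul_le_mul_of_nonneg_left hstar hτpos.le
    linarith
  have h7 : 19 / 20 * τ ≤ U + τ * (n₀ + 1 / 100) := by
    have := div_le_div_of_nonneg_right h6 hL2pos.le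
    rw [show (U * (L : ℝ) ^ 2 + τ * ((n₀ + 1 / 100) * (L : ℝ) ^ 2)) / (L : ℝ) ^ 2 = U + τ * (n₀ + 1 / 100) by
      field_simp] at this
    rwa [mul_div_assoc, div_self hL2pos.ne', mul_one] at this
  have hU' : U ≤ τ / 100 := by simp only [hτ]; linarith
  nlinarith


/-- **Lower end of the chemical-potential window.** For `0 ≤ U ≤ 3/2000` and a density `n₀ ≥ 3/5`
(`n₀ < 2`), every subgradient `s` at `n₀` of `energyDensity2D 1 U` on `[0,2)` satisfies
`-39/10 ≤ s` (the free density just above the band bottom, at `μ = -15/4`, is `≤ 1/2`,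
`card_filter_torusBand_lt_lowerEdge`; same argument as the upper edge, raising `μ` from `-39/10`
to `-15/4`). [folklore] -/
theorem lowerEdge_le_subgradient {U : ℝ} (hU0 : 0 ≤ U) (hU : U ≤ 3 / 2000) {n₀ : ℝ}
    (hn6 : 3 / 5 ≤ n₀) (hn2 : n₀ < 2) {s : ℝ}
    (hs : ∀ y ∈ Set.Ico (0 : ℝ) 2, energyDensity2D 1 U n₀ + s * (y - n₀) ≤ energyDensity2D 1 U y) :
    -39 / 10 ≤ s := by
  have hn0 : 0 ≤ n₀ := by linarith
  by_contra hlt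
  rw [not_le] at hlt
  -- `μ₁ = -39/10`, `ν' = -15/4 = μ₁ + τ'`, `τ' = 3/20`
  set g : ℝ := -39 / 10 - s with hg
  have hgpos : 0 < g := by simp only [hg]; linarith
  set η : ℝ := g / 200 with hη
  have hηpos : 0 < η := by positivity
  obtain ⟨L₁, hL₁⟩ := master_lb hU0 hs hηpos
  obtain ⟨L₂, hL₂⟩ := master_ub hU0 hn0 hn2 hηpos
  set L : ℕ := max (max L₁ L₂) 4 with hL
  have hLL₁ : L₁ ≤ L := (le_max_left _ _).trans (le_max_left _ _)
  have hLL₂ : L₂ ≤ L := (le_max_right _ _).trans (le_max_left _ _)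
  have hL4 : 4 ≤ L := le_max_right _ _
  haveI : NeZero L := ⟨by omega⟩
  have hL3 : 3 ≤ L := by omega
  have hL2pos : (0 : ℝ) < (L : ℝ) ^ 2 := by positivity
  set e₀ := energyDensity2D 1 U n₀ with he₀
  set E : ℕ → ℝ := fun N => groundEnergyAt (fermionTorusGraph 2 L) 1 U N with hE
  set G : ℝ → ℝ := fun μ => (hubbardTorusWith 2 L 1 U μ).groundEnergy with hG
  set G0 : ℝ → ℝ := fun μ => (hubbardTorusWith 2 L 1 0 μ).groundEnergy with hG0
  -- (iii') `G(μ₁) ≤ L² e₀ + η L² + (39/10) n₀ L²`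
  have hNL := rectN_le_two_mul hn0 hn2.le L
  have h3 : G (-39 / 10) ≤ (L : ℝ) ^ 2 * e₀ + η * (L : ℝ) ^ 2 + 39 / 10 * (n₀ * (L : ℝ) ^ 2) := by
    have h1 := gc_le_sector L U (-39 / 10) hNL
    have h2 := hL₂ L hLL₂
    have h4 := rectN_le hn0 L
    simp only [hG]
    nlinarith
  -- (ii') the ground sector at `μ₁`: `N₁ ≥ (n₀ - 1/100) L²`
  obtain ⟨N, hN2, hGN⟩ := exists_gcSector L U (-39 / 10)
  have h2 := hL₁ L hLL₁ N hN2
  have hstar : (n₀ - 1 / 100) * (L : ℝ) ^ 2 ≤ N := by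
    have h5 : g * (n₀ * (L : ℝ) ^ 2 - N) ≤ 2 * η * (L : ℝ) ^ 2 := by
      have : G (-39 / 10) = E N - (-39 / 10) * N := hGN
      simp only [hg]
      nlinarith [h2, h3, this]
    have h6 : n₀ * (L : ℝ) ^ 2 - N ≤ 2 * η * (L : ℝ) ^ 2 / g := by
      rw [le_div_iff₀ hgpos]; linarith
    have h7 : 2 * η * (L : ℝ) ^ 2 / g = (L : ℝ) ^ 2 / 100 := by
      simp only [hη]; field_simp; ring
    rw [h7] at h6
    linarith
  -- (iv') `G(ν') ≤ G(μ₁) - τ' N₁`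
  have h4 : G (-15 / 4) ≤ G (-39 / 10) - 3 / 20 * N := by
    have h1 := gc_le_sector L U (-15 / 4) hN2
    have : G (-39 / 10) = E N - (-39 / 10) * N := hGN
    simp only [hG] at *
    linarith
  -- (v') free comparison
  have h5 : G (-39 / 10) ≤ G (-15 / 4) + 3 / 40 * (L : ℝ) ^ 2 + U * (L : ℝ) ^ 2 := by
    have hA := (groundEnergy_torus_sub_free_mem_Icc L 1 (-39 / 10) hU0).2
    have hB := (groundEnergy_torus_sub_free_mem_Icc L 1 (-15 / 4) hU0).1
    have hC := groundEnergy_free_le_add_card (L := L) hL3 (μ := -15 / 4) (μ' := -39 / 10) (by norm_num)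
    have hD := card_filter_torusBand_lt_lowerEdge (L := L) hL4
    simp only [hG, hG0] at *
    nlinarith [hC, hD]
  -- contradiction
  have h6 : 3 / 20 * ((n₀ - 1 / 100) * (L : ℝ) ^ 2) ≤ 3 / 40 * (L : ℝ) ^ 2 + U * (L : ℝ) ^ 2 := by
    nlinarith
  have h7 : 3 / 20 * (n₀ - 1 / 100) ≤ 3 / 40 + U := by
    by_contra h8
    rw [not_le] at h8
    have := mul_lt_mul_of_pos_right h8 hL2pos
    nlinarith
  nlinarith


/-- **(GSEE) — ground-state ensemble equivalence for the pure Hubbard torus at `T = 0`.** For every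
`δ ∈ [1/10, 2/5]` there are the `δ`-uniform window `[μ₁, μ₂] = [-39/10, -cos²(49π/100)/2] ⊂ (-4, 0)`
and `U₀ = min(cos²(49π/100)/200, 3/2000)` such that for `0 < U ≤ U₀` a chemical potential
`μ ∈ [μ₁, μ₂]` — any subgradient at `1 - δ` of the convex limiting energy density
`energyDensity2D 1 U` — puts the `(N_L, S^z = 0)` ground energy of the canonical torus within
`εL²` of the supporting line of slope `μ` under ALL sector energies, eventually in `L`.
[cite: Ruelle1969, §3.4] -/
theorem gsee :
    ∀ δ ∈ Set.Icc (1/10 : ℝ) (2/5 : ℝ), ∃ μ₁ μ₂ : ℝ, -4 < μ₁ ∧ μ₁ ≤ μ₂ ∧ μ₂ < 0 ∧ ∃ U₀ : ℝ, 0 < U₀ ∧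
      ∀ U ∈ Set.Ioc (0 : ℝ) U₀, ∃ μ ∈ Set.Icc μ₁ μ₂, ∀ ε : ℝ, 0 < ε → ∃ L₀ : ℕ, ∀ (L : ℕ) [NeZero L], L₀ ≤ L →
        ∀ N' : ℕ, N' ≤ 2 * Fintype.card (FermionTorus 2 L) →
          (hubbardTorus 2 L 1 U).minEnergyOn (szSector (Λ := FermionTorus 2 L) (2 * ⌊(1 - δ) * (L : ℝ) ^ 2 / 2⌋₊) 0)
              - μ * ((2 * ⌊(1 - δ) * (L : ℝ) ^ 2 / 2⌋₊ : ℕ) : ℝ) ≤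
            groundEnergyAt (fermionTorusGraph 2 L) 1 U N' - μ * N' + ε * (L : ℝ) ^ 2 := by
  intro δ hδ
  obtain ⟨hδ1, hδ2⟩ := hδ
  set c₁ : ℝ := Real.cos (49 * Real.pi / 100) ^ 2 with hc₁
  have hc₁pos : 0 < c₁ := by have := upperEdge_neg; simp only [hc₁]; linarith
  have hc₁le : c₁ ≤ 1 := by
    simp only [hc₁]
    have h1 := Real.abs_cos_le_one (49 * Real.pi / 100)
    have h2 : Real.cos (49 * Real.pi / 100) ^ 2 = |Real.cos (49 * Real.pi / 100)| ^ 2 := (sq_abs _).symm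
    rw [h2]; nlinarith [abs_nonneg (Real.cos (49 * Real.pi / 100))]
  refine ⟨-39 / 10, -c₁ / 2, by norm_num, by linarith, by linarith, min (c₁ / 200) (3 / 2000),
    lt_min (by positivity) (by norm_num), fun U hU => ?_⟩
  obtain ⟨hUpos, hUle⟩ := hU
  have hU0 : 0 ≤ U := hUpos.le
  set n₀ : ℝ := 1 - δ with hn₀
  have hn6 : 3 / 5 ≤ n₀ := by simp only [hn₀]; linarith
  have hn9 : n₀ ≤ 9 / 10 := by simp only [hn₀]; linarith
  have hn0 : 0 < n₀ := by linarith
  have hn2 : n₀ < 2 := by linarith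
  -- a subgradient at `n₀` of the convex energy density
  obtain ⟨s, hs⟩ := exists_subgradient_of_convexOn_Ico (convexOn_energyDensity2D 1 hU0) ⟨hn0, hn2⟩
  have hs1 := subgradient_le_upperEdge hU0 (hUle.trans (min_le_left _ _)) hn0.le hn9 hs
  have hs2 := lowerEdge_le_subgradient hU0 (hUle.trans (min_le_right _ _)) hn6 hn2 hs
  refine ⟨s, ⟨hs2, by simp only [hc₁] at hs1 ⊢; linarith⟩, fun ε hε => ?_⟩
  have hη : 0 < ε / 4 := by positivity
  obtain ⟨L₁, hL₁⟩ := master_lb hU0 hs hη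
  obtain ⟨L₂, hL₂⟩ := master_ub hU0 hn0.le hn2 hη
  obtain ⟨L₃, hL₃⟩ := exists_nat_gt (4 * |s| / ε)
  refine ⟨max (max L₁ L₂) (max L₃ 1), fun L _ hL N' hN' => ?_⟩
  have hLL₁ : L₁ ≤ L := (le_max_left _ _).trans ((le_max_left _ _).trans hL)
  have hLL₂ : L₂ ≤ L := (le_max_right _ _).trans ((le_max_left _ _).trans hL)
  have hLL₃ : L₃ ≤ L := (le_max_left _ _).trans ((le_max_right _ _).trans hL)
  have hL1 : 1 ≤ L := (le_max_right _ _).trans ((le_max_right _ _).trans hL)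
  have hL1r : (1 : ℝ) ≤ L := by exact_mod_cast hL1
  have hL2pos : (0 : ℝ) < (L : ℝ) ^ 2 := by positivity
  -- the `(N_L, 0)` sector energy is the `N_L`-sector energy (`SU(2)`)
  have hNL : 2 * ⌊(1 - δ) * (L : ℝ) ^ 2 / 2⌋₊ = rectN n₀ L := rfl
  have hhalf : ⌊(1 - δ) * (L : ℝ) ^ 2 / 2⌋₊ ≤ Fintype.card (FermionTorus 2 L) := by
    have h := rectN_le_two_mul hn0.le hn2.le L
    rw [card_fermionTorus_two']
    rw [← hNL] at h; omega
  have hSU2 := groundEnergyAt_eq_minEnergyOn_szSector (fermionTorusGraph 2 L) 1 U hhalf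
  rw [show hubbardTorus 2 L 1 U = hamiltonian (fermionTorusGraph 2 L) 1 U from rfl, ← hSU2, hNL]
  -- master bounds
  rw [card_fermionTorus_two'] at hN'
  have h1 := hL₁ L hLL₁ N' hN'
  have h2 := hL₂ L hLL₂
  have h3 := rectN_le hn0.le L
  have h4 := lt_rectN_add_two n₀ L
  have hslack : 2 * |s| ≤ ε / 2 * (L : ℝ) ^ 2 := by
    have : 4 * |s| / ε < L := hL₃.trans_le (by exact_mod_cast hLL₃)
    rw [div_lt_iff₀ hε] at this
    nlinarith [abs_nonneg s]
  have h5 : s * (n₀ * (L : ℝ) ^ 2 - rectN n₀ L) ≤ 2 * |s| := by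
    calc s * (n₀ * (L : ℝ) ^ 2 - rectN n₀ L) ≤ |s * (n₀ * (L : ℝ) ^ 2 - rectN n₀ L)| := le_abs_self _
      _ = |s| * |n₀ * (L : ℝ) ^ 2 - rectN n₀ L| := abs_mul _ _
      _ ≤ |s| * 2 := mul_le_mul_of_nonneg_left (abs_le.2 ⟨by linarith, by linarith⟩) (abs_nonneg s)
      _ = 2 * |s| := by ring
  nlinarith [h1, h2, h5, hslack]


/-- **The verbatim body of `ThermalWedge.TwPureThermalBound`** (route `HubbardSuperconductivity/
ThermalWedge`, item stmt-HubbardSuperconductivity-1702): the canonical `(N_L, S^z=0)` ground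
energy per site plus the grand-canonical torus pressure minus `μ N_L/L²` is at most `log 4/β + ε`,
eventually in `L`, for a `δ`-uniform `μ ∈ [μ₁, μ₂] ⊂ (-4, 0)` — (GSEE) fed into the reduction
`twPureThermalBound_of_gsee` (`Z ≤ 4^{L²} e^{-βE₀}`, `E₀ = min_N (E(N) - μN)`). [cite: Ruelle1969, §3.4] -/
theorem twPureThermalBound_body :
    ∀ δ ∈ Set.Icc (1/10 : ℝ) (2/5 : ℝ), ∃ μ₁ μ₂ : ℝ, -4 < μ₁ ∧ μ₁ ≤ μ₂ ∧ μ₂ < 0 ∧ ∃ U₀ : ℝ, 0 < U₀ ∧ ∀ U ∈ Set.Ioc (0 : ℝ) U₀, ∀ β : ℝ, 1 ≤ β → ∃ μ ∈ Set.Icc μ₁ μ₂, ∀ ε : ℝ, 0 < ε → ∃ L₀ : ℕ, ∀ (L : ℕ) [NeZero L], L₀ ≤ L → ((Literature.MathematicalPhysics.QuantumLattice.hubbardTorus 2 L 1 U).minEnergyOn (Literature.MathematicalPhysics.QuantumLattice.szSector (Λ := Literature.MathematicalPhysics.QuantumLattice.FermionTorus 2 L) (2 * ⌊(1 - δ) *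 (L : ℝ) ^ 2 / 2⌋₊) 0) / (L : ℝ) ^ 2) + (Real.log (Matrix.partitionFn β (Literature.MathematicalPhysics.QuantumLattice.hubbardTorusWith 2 L 1 U μ)).re / (β * (L : ℝ) ^ 2)) - μ * ((2 * ⌊(1 - δ) * (L : ℝ) ^ 2 / 2⌋₊) : ℝ) / (L : ℝ) ^ 2 ≤ Real.log 4 / β + ε :=
  Summit.HubbardSuperconductivity.HubbardSuperconductivity.Theorems.twPureThermalBound_of_gsee gsee

end Torus

end Summit.HubbardSuperconductivity.HubbardSuperconductivity.Theorems.TwPureThermalBoundGsee
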